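import Literature.NumberTheory.Transcendental.BrownZagierTailSums
import Literature.NumberTheory.Transcendental.BrownDepthOneLift
import Literature.Analysis.SpecialFunctions.CotangentMoments
import Mathlib.Analysis.SpecialFunctions.Integrals.Basic
import Mathlib.MeasureTheory.Integral.IntervalIntegral.IntegrationByParts
import Mathlib.MeasureTheory.Integral.DominatedConvergence
import HarnessLib

/-!
# Brown, *Mixed Tate motives over ℤ* — Zagier's theorem for ALL weights (Brown's Theorem 4.1 =
# Zagier 2012, Theorem 1), and the Hoffman reduction without the hypothesis `hZ`

Sibling proof file in the cone of the named fact
`Literature.NumberTheory.Transcendental.hoffmanSpan_eq_mzvSpace` (Brown 2012, Theorem 1.1 ⟹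
Hoffman's conjecture). The tree reduces that fact to two inputs
(`hoffmanSpan_eq_mzvSpace_of_uCoactionData` in `BrownDepthOneLift`): the motivic coaction structure
`Brown2012.UCoactionData` and Zagier's REAL evaluation of `ζ(2,…,2,3,2,…,2)` for all `a, b`, taken
there as the explicit hypothesis `hZ` (proved in the tree only in weights `≤ 9`,
`BrownZagierFormulaLowWeightProofs`). This file PROVES Zagier's theorem for all `a, b`
(`LaiLupuOrr.zagier_theorem`, `…_printed`, `…_hZ`) by the elementary method of Lai–Lupu–Orr
[LaiLupuOrr2026, §3], and removes `hZ`: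

* `hoffmanSpan_eq_mzvSpace_of_uCoactionData'` / `…_of_fullCoactionData'` — Brown's Hoffman theorem
  from the motivic structure ALONE;
* `multipleZeta_odd_mem_hoffmanSpan` — **`ζ(2n+1) ∈ hoffmanSpan (2n+1)` for every `n ≥ 1`**, and
  `multipleZeta_odd_mul_twos_mem_hoffmanSpan` (`ζ(2j+3) ζ({2}^{n-1-j})`), UNCONDITIONALLY: Brown's
  Theorem 1.1 at level one needs no motives (Zagier's theorem + the `2`-adic Lemma 7.1,
  `BrownLevelOneProofs`).

## The proof of Zagier's theorem (Lai–Lupu–Orr 2026, §3), in the angle variable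

With `H(a,b) = ζ(2ᵃ 3 2ᵇ)` in Zagier's increasing convention, i.e. the tree's
`multipleZeta (replicate b 2 ++ 3 :: replicate a 2)` (decreasing indices; cf. `BrownLevelOneProofs`,
`BrownZagierTailSums`), `E_b(n) = MZV.tailSum b n` the tails `∑_{m₁>⋯>m_b>n} ∏ mⱼ⁻²` and
`Z_n({2}ᵃ) = MZV.mzvTrunc (replicate a 2) n`:

1. **Lemma 3.1** (`LaiLupuOrr.cosMoment_eq`): the moments
   `I_{n,b} = ∫₀^{π/2} cos^{2n}t (2t)^{2b}/(2b)! dt = C(2n,n)/4ⁿ · (π/2) · E_b(n)`, by a double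
   induction from Wallis (`b = 0`, Mathlib's `integral_cos_pow`), `∫₀^{π/2}(2t)^{2b}/(2b)! = (π/2)π^{2b}/(2b+1)!`
   (`n = 0`, `E_b(0) = ζ({2}ᵇ) = π^{2b}/(2b+1)!`) and the two integrations by parts
   `J_{n,b} := ∫ cos^{2n+1} sin · (2t)^{2b+1}/(2b+1)! = I_{n+1,b}/(n+1)` (`cosSinMoment_eq`) and
   `(2n+2) I_{n+1,b+1} = (2n+1) I_{n,b+1} - 2 J_{n,b}` (`cosMoment_succ_succ`), matched with the tail
   recursion `E_{b+1}(n) = E_{b+1}(n+1) + (n+1)⁻² E_b(n+1)` (`MZV.tailSum_succ_eq`) and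
   `(n+1) C(2n+2,n+1) = 2(2n+1) C(2n,n)`.
2. **Theorem 3.2** (`LaiLupuOrr.integral_cot_hoffman`):
   `∫₀^{π/2} (2t)^{2a+2} cot t (π-2t)^{2b+1} dt = (2a+2)! (2b+1)! (π/2) H(a,b)`: at `x = sin t`,
   `t < π/2`, the Borwein–Chamberland series gives `(2t)^{2a+2}/(2a+2)! = ∑ₙ c_a(n) sin^{2n} t`
   (`Literature.Analysis.SpecialFunctions.hasSum_arcsinCoeff`, `c_a(n) = 4ⁿ Z_n({2}ᵃ)/(n² C(2n,n))`);
   multiplying by `cot t (π-2t)^{2b+1}/(2b+1)!` and integrating termwise (all terms are nonnegative: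
   `intervalIntegral.hasSum_integral_of_dominated_convergence` with the terms as their own bound and
   `t cot t ≤ 1` for the integrability of the sum), the `n`-th term is, after the reflection
   `t ↦ π/2 - t`, `c_a(n) J_{n-1,b} = (π/2) E_b(n) Z_n({2}ᵃ)/n³`, and
   `∑ₙ E_b(n) n⁻³ Z_n({2}ᵃ) = H(a,b)` is `MZV.multipleZeta_twos_three_twos_eq_tsum` (`BrownZagierTailSums`).
   This replaces the substitutions `x = sin t`, `arccos x = π/2 - arcsin x` of the printed proof.
3. **Theorem 3.3** (`LaiLupuOrr.integral_hoffPoly_mul_cot`): for `P = X^{2a+2}(1-X)^{2b+1}`,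
   `P⁽²ʲ⁾(0) = (2j)! C(2b+1,2j-2a-2)` and `P⁽²ʲ⁾(1) = -(2j)! C(2a+2,2j-2b-1)` (`P = Q(1-X)`,
   `Q = X^{2b+1}(1-X)^{2a+2}`), so the cotangent moment theorem
   `Literature.Analysis.SpecialFunctions.integral_polynomial_mul_cot` (= [LaiLupuOrr2026, Lemma 2.3])
   and the bookkeeping `(2j)! C(2b+1,2j-2a-2) (2n+1-2j)! = (2a+2)!(2b+1)! C(2j,2a+2)` (and its mirror)
   evaluate `∫₀¹ P(x) cot(πx/2) dx`; the substitution `t = πx/2` (`integral_cot_hoffman_unit`) and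
   `ζ({2}ᵐ) = π^{2m}/(2m+1)!` (`multipleZeta_replicate_two`) give Zagier's formula with
   `c^k_{a,b} = C(2k,2a+2) - (1-2^{-2k}) C(2k,2b+1) = A^k_a - B^k_b` (`Brown2012.zagierA/zagierB`).

No new definitions of mathematical content (the `def`s `pw`, `cosMoment`, `cosSinMoment`, `cw`,
`hoffTerm`, `hoffIntegrand`, `hoffPoly`, `hoffPoly'` are local abbreviations for integrands and
integrals of the proof); no named facts (net debt `0`); everything is proved.

## References

* [LaiLupuOrr2026] L. Lai, C. Lupu, D. Orr, *Elementary proofs of Zagier's formula for multiple zeta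
  values and its odd variant*, Proc. AMS 154 (2026), 11–24 (arXiv:2201.09262): Lemma 3.1,
  Theorem 3.2, Theorem 3.3, Theorem 1.1 (pp. 6–9 of the arXiv version).
* [Zagier2012] D. Zagier, *Evaluation of the multiple zeta values ζ(2,…,2,3,2,…,2)*, Ann. of Math.
  175 (2012), 977–1000, Theorem 1.
* [Brown2012] F. Brown, *Mixed Tate motives over ℤ*, Ann. of Math. 175 (2012), 949–976: Theorem 4.1
  (Zagier's theorem as used), Theorems 7.3–7.4 and §7.2 (Theorem 1.1 ⟹ Hoffman's Conjecture 2).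
-/

noncomputable section

open Filter Set Real MeasureTheory intervalIntegral
open scoped Topology BigOperators Nat

namespace Literature.NumberTheory.Transcendental

namespace LaiLupuOrr

/-- The normalised powers `(2t)ᵐ / m!`. [folklore] -/
def pw (m : ℕ) (t : ℝ) : ℝ := (2 * t) ^ m / m !

/-- Unfolding `pw`. [folklore] -/
theorem pw_def (m : ℕ) (t : ℝ) : pw m t = (2 * t) ^ m / m ! := rfl

/-- `pw 0 = 1`. [folklore] -/
@[simp] theorem pw_zero (t : ℝ) : pw 0 t = 1 := by simp [pw]

/-- `pw (m+1) 0 = 0`. [folklore] -/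
theorem pw_succ_zero (m : ℕ) : pw (m + 1) 0 = 0 := by simp [pw]

/-- `pw m t ≥ 0` for `t ≥ 0`. [folklore] -/
theorem pw_nonneg (m : ℕ) {t : ℝ} (ht : 0 ≤ t) : 0 ≤ pw m t := by
  unfold pw; positivity

/-- `pw m` is continuous. [folklore] -/
@[fun_prop]
theorem continuous_pw (m : ℕ) : Continuous (pw m) := by
  unfold pw; fun_prop

/-- `pw m` is continuous (lambda form, for `fun_prop`). [folklore] -/
@[fun_prop]
theorem continuous_pw' (m : ℕ) : Continuous (fun t => pw m t) := continuous_pw m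

/-- `d/dt (2t)^{m+1}/(m+1)! = 2 (2t)^m/m!`. [folklore] -/
theorem hasDerivAt_pw_succ (m : ℕ) (t : ℝ) : HasDerivAt (pw (m + 1)) (2 * pw m t) t := by
  have h1 : HasDerivAt (fun y : ℝ => 2 * y) 2 t := by
    simpa using (hasDerivAt_id t).const_mul (2 : ℝ)
  have h2 : HasDerivAt (pw (m + 1))
      (((m + 1 : ℕ) : ℝ) * (2 * t) ^ (m + 1 - 1) * 2 / ((m + 1)! : ℝ)) t :=
    (h1.pow (m + 1)).div_const _
  convert h2 using 1
  simp only [Nat.add_sub_cancel, Nat.factorial_succ, Nat.cast_mul, Nat.cast_add, Nat.cast_one, pw_def]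
  have : ((m ! : ℕ) : ℝ) ≠ 0 := by positivity
  field_simp

/-- `I n b = ∫₀^{π/2} cos^{2n} t · (2t)^{2b}/(2b)! dt`. [folklore] -/
def cosMoment (n b : ℕ) : ℝ := ∫ t in (0 : ℝ)..π / 2, cos t ^ (2 * n) * pw (2 * b) t

/-- `J n b = ∫₀^{π/2} cos^{2n+1} t · sin t · (2t)^{2b+1}/(2b+1)! dt`. [folklore] -/
def cosSinMoment (n b : ℕ) : ℝ :=
  ∫ t in (0 : ℝ)..π / 2, cos t ^ (2 * n + 1) * sin t * pw (2 * b + 1) t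

/-- Unfolding `I (n+1) b` with the exponent `2n+2`. [folklore] -/
theorem cosMoment_succ_left (n b : ℕ) :
    cosMoment (n + 1) b = ∫ t in (0 : ℝ)..π / 2, cos t ^ (2 * n + 2) * pw (2 * b) t := by
  rw [cosMoment]; rfl

/-- Wallis: `I n 0 = (π/2) · C(2n,n)/4ⁿ`.
[cite: LaiLupuOrr2026, Lemma 3.1 (case b = 0, Wallis)] -/
theorem cosMoment_zero_right : ∀ n : ℕ, cosMoment n 0 = π / 2 * ((n.centralBinom : ℝ) / 4 ^ n)
  | 0 => by simp [cosMoment]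
  | n + 1 => by
      have h := cosMoment_zero_right n
      simp only [cosMoment, mul_zero, pw_zero, mul_one] at h ⊢
      rw [show 2 * (n + 1) = 2 * n + 2 by ring, integral_cos_pow, h, cos_pi_div_two, sin_zero]
      simp only [mul_zero, sub_zero, zero_pow (Nat.succ_ne_zero _), zero_mul, zero_div, zero_add]
      have hr : ((n : ℝ) + 1) * ((n + 1).centralBinom : ℝ) = 2 * (2 * n + 1) * (n.centralBinom : ℝ) := by
        exact_mod_cast Nat.succ_mul_centralBinom_succ n
      have hC : ((n + 1).centralBinom : ℝ) = 2 * (2 * n + 1) * (n.centralBinom : ℝ) / (n + 1) := by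
        rw [eq_div_iff (by positivity)]; linarith [hr]
      rw [hC, pow_succ]
      push_cast
      field_simp
      ring

/-- `I 0 b = (π/2) · π^{2b}/(2b+1)!`. [cite: LaiLupuOrr2026, Lemma 3.1 (case n = 0)] -/
theorem cosMoment_zero_left (b : ℕ) : cosMoment 0 b = π / 2 * (π ^ (2 * b) / (2 * b + 1)!) := by
  simp only [cosMoment, mul_zero, pow_zero, one_mul, pw_def]
  rw [intervalIntegral.integral_div, intervalIntegral.integral_comp_mul_left (fun u => u ^ (2 * b))
    two_ne_zero, integral_pow]
  simp only [mul_zero, smul_eq_mul]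
  rw [show (2 : ℝ) * (π / 2) = π by ring, Nat.factorial_succ]
  push_cast
  have : ((2 * b)! : ℝ) ≠ 0 := by positivity
  field_simp
  ring

/-- All the integrands here are continuous, hence interval integrable. [folklore] -/
theorem intervalIntegrable_of_continuous {f : ℝ → ℝ} (hf : Continuous f) (a b : ℝ) :
    IntervalIntegrable f volume a b :=
  hf.intervalIntegrable a b

/-- First integration by parts: `J n b = I (n+1) b / (n+1)`.
[cite: LaiLupuOrr2026, Lemma 3.1, eq. (5)] -/
theorem cosSinMoment_eq (n b : ℕ) : cosSinMoment n b = cosMoment (n + 1) b / (n + 1) := by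
  have hn : (2 * (n : ℝ) + 2) ≠ 0 := by positivity
  have hn' : ((n : ℝ) + 1) ≠ 0 := by positivity
  have hu : ∀ x ∈ uIcc (0 : ℝ) (π / 2), HasDerivAt (pw (2 * b + 1)) (2 * pw (2 * b) x) x :=
    fun x _ => hasDerivAt_pw_succ _ x
  have hv : ∀ x ∈ uIcc (0 : ℝ) (π / 2),
      HasDerivAt (fun t => -(cos t ^ (2 * n + 2)) / (2 * n + 2)) (cos x ^ (2 * n + 1) * sin x) x := by
    intro x _
    have h : HasDerivAt (fun t => -(cos t ^ (2 * n + 2)) / (2 * n + 2))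
        (-(((2 * n + 2 : ℕ) : ℝ) * cos x ^ (2 * n + 2 - 1) * -sin x) / (2 * n + 2)) x :=
      (((hasDerivAt_cos x).pow (2 * n + 2)).neg).div_const (2 * n + 2 : ℝ)
    convert h using 1
    have e : 2 * n + 2 - 1 = 2 * n + 1 := by omega
    rw [e]
    push_cast
    field_simp
  have hibp := integral_mul_deriv_eq_deriv_mul hu hv
    (intervalIntegrable_of_continuous (by fun_prop) _ _)
    (intervalIntegrable_of_continuous (by fun_prop) _ _)
  have e1 : cosSinMoment n b =
      ∫ t in (0 : ℝ)..π / 2, pw (2 * b + 1) t * (cos t ^ (2 * n + 1) * sin t) := by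
    rw [cosSinMoment]
    exact integral_congr fun t _ => by ring
  have e2 : (∫ x in (0 : ℝ)..π / 2, 2 * pw (2 * b) x * (-(cos x ^ (2 * n + 2)) / (2 * n + 2))) =
      -(cosMoment (n + 1) b / (n + 1)) := by
    rw [cosMoment_succ_left, ← neg_div, ← intervalIntegral.integral_neg,
      ← intervalIntegral.integral_div]
    refine integral_congr fun x _ => ?_
    field_simp
  rw [e1, hibp, e2, cos_pi_div_two, pw_succ_zero, zero_pow (Nat.succ_ne_zero _), neg_zero, zero_div,
    mul_zero, zero_mul, sub_zero, zero_sub, neg_neg]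

/-- Second integration by parts, solved for the new moment:
`I (n+1) (b+1) = ((2n+1) I n (b+1) - 2 J n b) / (2n+2)`.
[cite: LaiLupuOrr2026, Lemma 3.1, eq. (4)] -/
theorem cosMoment_succ_succ (n b : ℕ) :
    cosMoment (n + 1) (b + 1) =
      ((2 * n + 1) * cosMoment n (b + 1) - 2 * cosSinMoment n b) / (2 * n + 2) := by
  have hn : (2 * (n : ℝ) + 2) ≠ 0 := by positivity
  -- u = cos^{2n+1} · pw (2b+2), v = sin
  have hu : ∀ x ∈ uIcc (0 : ℝ) (π / 2),
      HasDerivAt (fun t => cos t ^ (2 * n + 1) * pw (2 * b + 2) t)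
        ((((2 * n + 1 : ℕ) : ℝ) * cos x ^ (2 * n) * (-sin x)) * pw (2 * b + 2) x +
          cos x ^ (2 * n + 1) * (2 * pw (2 * b + 1) x)) x := by
    intro x _
    exact ((hasDerivAt_cos x).pow (2 * n + 1)).mul (hasDerivAt_pw_succ (2 * b + 1) x)
  have hv : ∀ x ∈ uIcc (0 : ℝ) (π / 2), HasDerivAt sin (cos x) x := fun x _ => hasDerivAt_sin x
  have hibp := integral_mul_deriv_eq_deriv_mul hu hv
    (intervalIntegrable_of_continuous (by fun_prop) _ _)
    (intervalIntegrable_of_continuous (by fun_prop) _ _)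
  -- the left-hand side of the integration by parts is `I (n+1) (b+1)`
  have e1 : cosMoment (n + 1) (b + 1) =
      ∫ t in (0 : ℝ)..π / 2, cos t ^ (2 * n + 1) * pw (2 * b + 2) t * cos t := by
    rw [cosMoment]
    exact integral_congr fun t _ => by ring
  -- the right-hand side, expanded
  have e2 : (∫ t in (0 : ℝ)..π / 2,
      ((((2 * n + 1 : ℕ) : ℝ) * cos t ^ (2 * n) * (-sin t)) * pw (2 * b + 2) t +
          cos t ^ (2 * n + 1) * (2 * pw (2 * b + 1) t)) * sin t) =
      -(2 * n + 1) * cosMoment n (b + 1) + (2 * n + 1) * cosMoment (n + 1) (b + 1)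
        + 2 * cosSinMoment n b := by
    have e3 : ∀ t : ℝ, ((((2 * n + 1 : ℕ) : ℝ) * cos t ^ (2 * n) * (-sin t)) * pw (2 * b + 2) t +
          cos t ^ (2 * n + 1) * (2 * pw (2 * b + 1) t)) * sin t =
        -(2 * n + 1) * (cos t ^ (2 * n) * pw (2 * (b + 1)) t)
          + (2 * n + 1) * (cos t ^ (2 * (n + 1)) * pw (2 * (b + 1)) t)
          + 2 * (cos t ^ (2 * n + 1) * sin t * pw (2 * b + 1) t) := by
      intro t
      have hs : sin t ^ 2 = 1 - cos t ^ 2 := by rw [sin_sq]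
      rw [show 2 * (b + 1) = 2 * b + 2 by ring, show 2 * (n + 1) = 2 * n + 2 by ring]
      push_cast
      linear_combination (-(2 * (n : ℝ) + 1) * cos t ^ (2 * n) * pw (2 * b + 2) t) * hs
    simp_rw [e3]
    rw [intervalIntegral.integral_add, intervalIntegral.integral_add,
      intervalIntegral.integral_const_mul, intervalIntegral.integral_const_mul,
      intervalIntegral.integral_const_mul, cosMoment, cosMoment, cosSinMoment]
    · exact intervalIntegrable_of_continuous (by fun_prop) _ _
    · exact intervalIntegrable_of_continuous (by fun_prop) _ _
    · exact (intervalIntegrable_of_continuous (by fun_prop) _ _)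
    · exact intervalIntegrable_of_continuous (by fun_prop) _ _
  have key := hibp
  rw [← e1, e2, cos_pi_div_two, sin_zero, zero_pow (Nat.succ_ne_zero _)] at key
  rw [eq_div_iff hn]
  linarith [key]

/-- **Lemma 3.1 of Lai–Lupu–Orr** (moments): `I n b = (π/2) · C(2n,n)/4ⁿ · E_b(n)`.
[cite: LaiLupuOrr2026, Lemma 3.1, eq. (3)] -/
theorem cosMoment_eq : ∀ n b : ℕ,
    cosMoment n b = π / 2 * ((n.centralBinom : ℝ) / 4 ^ n) * MZV.tailSum b n
  | 0, b => by
      rw [cosMoment_zero_left, MZV.tailSum_zero_right_eq]; simp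
  | n + 1, 0 => by
      rw [cosMoment_zero_right, MZV.tailSum_zero, mul_one]
  | n + 1, b + 1 => by
      have htail := MZV.tailSum_succ_eq b n
      have hr : ((n : ℝ) + 1) * ((n + 1).centralBinom : ℝ) = 2 * (2 * n + 1) * (n.centralBinom : ℝ) := by
        exact_mod_cast Nat.succ_mul_centralBinom_succ n
      have hn : (2 * (n : ℝ) + 2) ≠ 0 := by positivity
      have hn' : ((n : ℝ) + 1) ≠ 0 := by positivity
      have h4 : (4 : ℝ) ^ n ≠ 0 := by positivity
      have hC : ((n + 1).centralBinom : ℝ) = 2 * (2 * n + 1) * (n.centralBinom : ℝ) / (n + 1) := by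
        rw [eq_div_iff hn']; linarith [hr]
      rw [cosMoment_succ_succ, cosSinMoment_eq, cosMoment_eq n (b + 1), cosMoment_eq (n + 1) b, hC,
        htail, pow_succ]
      field_simp
      ring

/-! ### Theorem 3.2: the Hoffman element as a cotangent integral -/

open Literature.Analysis.SpecialFunctions (arcsinCoeff arcsinNestedSum hasSum_arcsinCoeff
  arcsinCoeff_nonneg arcsinCoeff_zero_right)

/-- The weight `w_b(t) = (π - 2t)^{2b+1}/(2b+1)!`. [folklore] -/
def cw (b : ℕ) (t : ℝ) : ℝ := (π - 2 * t) ^ (2 * b + 1) / (2 * b + 1)!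

/-- The terms `F_n(t) = c_a(n) sin^{2n} t · cot t · w_b(t)` of the integrand series. [folklore] -/
def hoffTerm (a b n : ℕ) (t : ℝ) : ℝ :=
  arcsinCoeff a n * sin t ^ (2 * n) * (cos t / sin t) * cw b t

/-- The integrand `f(t) = (2t)^{2a+2}/(2a+2)! · cot t · w_b(t)`. [folklore] -/
def hoffIntegrand (a b : ℕ) (t : ℝ) : ℝ :=
  (2 * t) ^ (2 * a + 2) / (2 * a + 2)! * (cos t / sin t) * cw b t

/-- `w_b ≥ 0` on `t ≤ π/2`. [folklore] -/
theorem cw_nonneg (b : ℕ) {t : ℝ} (ht : t ≤ π / 2) : 0 ≤ cw b t := by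
  unfold cw
  have : 0 ≤ π - 2 * t := by linarith
  positivity

/-- `w_b(t) ≤ π^{2b+1}` on `[0, π/2]`. [folklore] -/
theorem cw_le (b : ℕ) {t : ℝ} (ht0 : 0 ≤ t) (ht : t ≤ π / 2) : cw b t ≤ π ^ (2 * b + 1) := by
  unfold cw
  have h0 : 0 ≤ π - 2 * t := by linarith
  have h1 : π - 2 * t ≤ π := by linarith
  have hf : (1 : ℝ) ≤ (2 * b + 1)! := by exact_mod_cast Nat.one_le_iff_ne_zero.mpr (Nat.factorial_ne_zero _)
  calc (π - 2 * t) ^ (2 * b + 1) / (2 * b + 1)! ≤ (π - 2 * t) ^ (2 * b + 1) :=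
        div_le_self (by positivity) hf
    _ ≤ π ^ (2 * b + 1) := pow_le_pow_left₀ h0 h1 _

/-- The reflection `t ↦ π/2 - t` turns `(2t)^{2b+1}/(2b+1)!` into `w_b`. [folklore] -/
theorem pw_pi_div_two_sub (b : ℕ) (t : ℝ) : pw (2 * b + 1) (π / 2 - t) = cw b t := by
  rw [cw, pw_def]; congr 1; ring

/-- The terms are measurable. [folklore] -/
@[fun_prop] theorem measurable_hoffTerm (a b n : ℕ) : Measurable (hoffTerm a b n) := by
  unfold hoffTerm cw; fun_prop

/-- The integrand is measurable. [folklore] -/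
@[fun_prop] theorem measurable_hoffIntegrand (a b : ℕ) : Measurable (hoffIntegrand a b) := by
  unfold hoffIntegrand cw; fun_prop

/-- `sin t < 1` for `0 ≤ t < π/2`. [folklore] -/
theorem sin_lt_one_of_lt {t : ℝ} (ht0 : 0 ≤ t) (ht : t < π / 2) : sin t < 1 := by
  rw [← sin_pi_div_two]
  exact strictMonoOn_sin ⟨by linarith [pi_pos], ht.le⟩ ⟨by linarith [pi_pos], le_rfl⟩ ht

/-- The power series of `(2 arcsin x)^{2a+2}/(2a+2)!` at `x = sin t`, multiplied through:
`∑ F_n(t) = f(t)` on `[0, π/2]`. [cite: LaiLupuOrr2026, §3 eq. (6)] -/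
theorem hasSum_hoffTerm (a b : ℕ) {t : ℝ} (ht0 : 0 ≤ t) (ht : t ≤ π / 2) :
    HasSum (fun n => hoffTerm a b n t) (hoffIntegrand a b t) := by
  rcases ht.eq_or_lt with rfl | hlt
  · have h1 : ∀ n, hoffTerm a b n (π / 2) = 0 := fun n => by simp [hoffTerm, cos_pi_div_two]
    have h2 : hoffIntegrand a b (π / 2) = 0 := by simp [hoffIntegrand, cos_pi_div_two]
    simp_rw [h1, h2]
    exact hasSum_zero
  · have hs1 : |sin t| < 1 := by
      rw [abs_of_nonneg (sin_nonneg_of_nonneg_of_le_pi ht0 (by linarith [pi_pos]))]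
      exact sin_lt_one_of_lt ht0 hlt
    have h := hasSum_arcsinCoeff a hs1
    rw [arcsin_sin (by linarith [pi_pos]) ht] at h
    have h' := (h.mul_right (cos t / sin t)).mul_right (cw b t)
    simpa only [hoffTerm, hoffIntegrand] using h'

/-- The terms are nonnegative on `[0, π/2]`. [folklore] -/
theorem hoffTerm_nonneg (a b n : ℕ) {t : ℝ} (ht0 : 0 ≤ t) (ht : t ≤ π / 2) : 0 ≤ hoffTerm a b n t := by
  unfold hoffTerm
  have hsin : 0 ≤ sin t := sin_nonneg_of_nonneg_of_le_pi ht0 (by linarith [pi_pos])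
  have hcos : 0 ≤ cos t := cos_nonneg_of_mem_Icc ⟨by linarith [pi_pos], ht⟩
  have := arcsinCoeff_nonneg a n
  have := cw_nonneg b ht
  positivity

/-- The integrand is nonnegative on `[0, π/2]`. [folklore] -/
theorem hoffIntegrand_nonneg (a b : ℕ) {t : ℝ} (ht0 : 0 ≤ t) (ht : t ≤ π / 2) :
    0 ≤ hoffIntegrand a b t := by
  unfold hoffIntegrand
  have hsin : 0 ≤ sin t := sin_nonneg_of_nonneg_of_le_pi ht0 (by linarith [pi_pos])
  have hcos : 0 ≤ cos t := cos_nonneg_of_mem_Icc ⟨by linarith [pi_pos], ht⟩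
  have := cw_nonneg b ht
  positivity

/-- The integrand is bounded on `(0, π/2]` (`t cot t ≤ 1`, crudely). [folklore] -/
theorem hoffIntegrand_le (a b : ℕ) {t : ℝ} (ht0 : 0 < t) (ht : t ≤ π / 2) :
    hoffIntegrand a b t ≤ π * π ^ (2 * a + 1) * π ^ (2 * b + 1) := by
  unfold hoffIntegrand
  have hsin : 0 < sin t := sin_pos_of_pos_of_lt_pi ht0 (by linarith [pi_pos])
  have hcos : 0 ≤ cos t := cos_nonneg_of_mem_Icc ⟨by linarith [pi_pos], ht⟩
  have hjordan : 2 / π * t ≤ sin t := mul_le_sin ht0.le ht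
  have h2t : 0 < 2 / π * t := by positivity
  have hf : (1 : ℝ) ≤ (2 * a + 2)! := by exact_mod_cast Nat.one_le_iff_ne_zero.mpr (Nat.factorial_ne_zero _)
  have step1 : (2 * t) ^ (2 * a + 2) / (2 * a + 2)! * (cos t / sin t) ≤
      (2 * t) ^ (2 * a + 2) * (1 / (2 / π * t)) := by
    have e1 : (2 * t) ^ (2 * a + 2) / (2 * a + 2)! ≤ (2 * t) ^ (2 * a + 2) :=
      div_le_self (by positivity) hf
    have e2 : cos t / sin t ≤ 1 / (2 / π * t) :=
      calc cos t / sin t ≤ 1 / sin t := div_le_div_of_nonneg_right (cos_le_one t) hsin.le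
        _ ≤ 1 / (2 / π * t) := one_div_le_one_div_of_le h2t hjordan
    exact mul_le_mul e1 e2 (div_nonneg hcos hsin.le) (by positivity)
  have step2 : (2 * t) ^ (2 * a + 2) * (1 / (2 / π * t)) = π * (2 * t) ^ (2 * a + 1) := by
    field_simp
    ring
  have step3 : (2 * t) ^ (2 * a + 1) ≤ π ^ (2 * a + 1) :=
    pow_le_pow_left₀ (by positivity) (by linarith) _
  calc (2 * t) ^ (2 * a + 2) / (2 * a + 2)! * (cos t / sin t) * cw b t
      ≤ (π * (2 * t) ^ (2 * a + 1)) * π ^ (2 * b + 1) := by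
        rw [← step2]
        exact mul_le_mul step1 (cw_le b ht0.le ht) (cw_nonneg b ht) (by positivity)
    _ ≤ (π * π ^ (2 * a + 1)) * π ^ (2 * b + 1) := by
        gcongr

/-- The term integrals: `∫₀^{π/2} F_n = (π/2) · E_b(n) · n⁻³ · Z_n({2}ᵃ)`.
[cite: LaiLupuOrr2026, Lemma 3.1 and proof of Theorem 3.2] -/
theorem integral_hoffTerm (a b n : ℕ) :
    ∫ t in (0 : ℝ)..π / 2, hoffTerm a b n t =
      π / 2 * (MZV.tailSum b n * ((((n : ℝ) ^ 3)⁻¹) * MZV.mzvTrunc (List.replicate a 2) n)) := by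
  rcases n with _ | m
  · simp [hoffTerm]
  · -- `sin^{2m+2} cot = sin^{2m+1} cos`
    have e1 : ∀ t : ℝ, hoffTerm a b (m + 1) t =
        arcsinCoeff a (m + 1) * (sin t ^ (2 * m + 1) * cos t * cw b t) := by
      intro t
      unfold hoffTerm
      rcases eq_or_ne (sin t) 0 with hs | hs
      · rw [hs]; simp
      · rw [show 2 * (m + 1) = 2 * m + 1 + 1 by ring, pow_succ]
        field_simp
    simp_rw [e1]
    rw [intervalIntegral.integral_const_mul]
    -- reflect `t ↦ π/2 - t`
    have e2 : (∫ t in (0 : ℝ)..π / 2, sin t ^ (2 * m + 1) * cos t * cw b t) = cosSinMoment m b := by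
      have h := intervalIntegral.integral_comp_sub_left
        (fun u => cos u ^ (2 * m + 1) * sin u * pw (2 * b + 1) u) (π / 2) (a := 0) (b := π / 2)
      simp only [cos_pi_div_two_sub, sin_pi_div_two_sub, sub_self, sub_zero] at h
      rw [cosSinMoment, ← h]
      refine integral_congr fun t _ => ?_
      rw [pw_pi_div_two_sub]
    rw [e2, cosSinMoment_eq, cosMoment_eq, ← MZV.arcsinNestedSum_eq_mzvTrunc, arcsinCoeff]
    have hC : ((m + 1).centralBinom : ℝ) ≠ 0 := by exact_mod_cast (Nat.centralBinom_pos _).ne'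
    have h4 : (4 : ℝ) ^ (m + 1) ≠ 0 := by positivity
    have hm : ((m + 1 : ℕ) : ℝ) ≠ 0 := by positivity
    push_cast
    field_simp

/-- **Theorem 3.2 of Lai–Lupu–Orr**, normalised form: `∫₀^{π/2} f = (π/2) H(a,b)` with
`H(a,b) = ζ(2ᵃ 3 2ᵇ)` (Zagier) `= multipleZeta (replicate b 2 ++ 3 :: replicate a 2)`.
[cite: LaiLupuOrr2026, Theorem 3.2, eq. (7)] -/
theorem integral_hoffIntegrand (a b : ℕ) :
    ∫ t in (0 : ℝ)..π / 2, hoffIntegrand a b t =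
      π / 2 * multipleZeta (List.replicate b 2 ++ 3 :: List.replicate a 2) := by
  have hI : uIoc (0 : ℝ) (π / 2) = Ioc 0 (π / 2) := uIoc_of_le (by positivity)
  -- termwise integration
  have hsum : HasSum (fun n => ∫ t in (0 : ℝ)..π / 2, hoffTerm a b n t)
      (∫ t in (0 : ℝ)..π / 2, hoffIntegrand a b t) := by
    refine intervalIntegral.hasSum_integral_of_dominated_convergence (hoffTerm a b)
      (fun n => (measurable_hoffTerm a b n).aestronglyMeasurable) (fun n => ?_) ?_ ?_ ?_
    · refine ae_of_all _ fun t ht => ?_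
      rw [hI] at ht
      rw [Real.norm_eq_abs, abs_of_nonneg (hoffTerm_nonneg a b n ht.1.le ht.2)]
    · refine ae_of_all _ fun t ht => ?_
      rw [hI] at ht
      exact (hasSum_hoffTerm a b ht.1.le ht.2).summable
    · have hmeas : AEStronglyMeasurable (fun t => ∑' n, hoffTerm a b n t)
          (volume.restrict (uIoc 0 (π / 2))) := by
        refine (measurable_hoffIntegrand a b).aestronglyMeasurable.congr ?_
        rw [Filter.EventuallyEq, ae_restrict_iff' measurableSet_uIoc]
        refine ae_of_all _ fun t ht => ?_
        rw [hI] at ht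
        exact ((hasSum_hoffTerm a b ht.1.le ht.2).tsum_eq).symm
      refine IntervalIntegrable.mono_fun' (g := fun _ => π * π ^ (2 * a + 1) * π ^ (2 * b + 1))
        intervalIntegrable_const hmeas ?_
      rw [Filter.EventuallyLE, ae_restrict_iff' measurableSet_uIoc]
      refine ae_of_all _ fun t ht => ?_
      rw [hI] at ht
      rw [(hasSum_hoffTerm a b ht.1.le ht.2).tsum_eq, Real.norm_eq_abs,
        abs_of_nonneg (hoffIntegrand_nonneg a b ht.1.le ht.2)]
      exact hoffIntegrand_le a b ht.1 ht.2
    · refine ae_of_all _ fun t ht => ?_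
      rw [hI] at ht
      exact hasSum_hoffTerm a b ht.1.le ht.2
  simp_rw [integral_hoffTerm] at hsum
  have hsum' := hsum.mul_left (2 / π)
  have hπ : π ≠ 0 := pi_ne_zero
  have e : ∀ n : ℕ, 2 / π * (π / 2 * (MZV.tailSum b n * ((((n : ℝ) ^ 3)⁻¹) *
      MZV.mzvTrunc (List.replicate a 2) n))) =
      MZV.tailSum b n * ((((n : ℝ) ^ 3)⁻¹) * MZV.mzvTrunc (List.replicate a 2) n) := by
    intro n; field_simp
  simp_rw [e] at hsum'
  rw [MZV.multipleZeta_twos_three_twos_eq_tsum, hsum'.tsum_eq]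
  field_simp

/-- **Theorem 3.2 of Lai–Lupu–Orr** in the angle variable:
`∫₀^{π/2} (2t)^{2a+2} cot t (π - 2t)^{2b+1} dt = (2a+2)! (2b+1)! (π/2) ζ(2ᵃ 3 2ᵇ)`.
[cite: LaiLupuOrr2026, Theorem 3.2] -/
theorem integral_cot_hoffman (a b : ℕ) :
    ∫ t in (0 : ℝ)..π / 2, (2 * t) ^ (2 * a + 2) * (cos t / sin t) * (π - 2 * t) ^ (2 * b + 1) =
      (2 * a + 2)! * (2 * b + 1)! *
        (π / 2 * multipleZeta (List.replicate b 2 ++ 3 :: List.replicate a 2)) := by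
  rw [← integral_hoffIntegrand, ← intervalIntegral.integral_const_mul]
  refine integral_congr fun t _ => ?_
  simp only [hoffIntegrand, cw]
  have h1 : ((2 * a + 2)! : ℝ) ≠ 0 := by positivity
  have h2 : ((2 * b + 1)! : ℝ) ≠ 0 := by positivity
  field_simp

/-- **Theorem 3.2 of Lai–Lupu–Orr** on `[0,1]` (substituting `t = πx/2`):
`π^{2a+2b+3} ∫₀¹ x^{2a+2} (1-x)^{2b+1} cot(πx/2) dx = (2a+2)! (2b+1)! ζ(2ᵃ 3 2ᵇ)`.
[cite: LaiLupuOrr2026, Theorem 3.2, eq. (7)] -/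
theorem integral_cot_hoffman_unit (a b : ℕ) :
    π ^ (2 * a + 2 * b + 3) *
        ∫ x in (0 : ℝ)..1, x ^ (2 * a + 2) * (1 - x) ^ (2 * b + 1) *
          (cos (π * x / 2) / sin (π * x / 2)) =
      (2 * a + 2)! * (2 * b + 1)! * multipleZeta (List.replicate b 2 ++ 3 :: List.replicate a 2) := by
  have hπ : π ≠ 0 := pi_ne_zero
  have h := intervalIntegral.integral_comp_mul_left
    (fun t => (2 * t) ^ (2 * a + 2) * (cos t / sin t) * (π - 2 * t) ^ (2 * b + 1))
    (c := π / 2) (a := 0) (b := 1) (by positivity)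
  simp only [mul_zero, mul_one] at h
  rw [integral_cot_hoffman] at h
  have e : ∀ x : ℝ, (2 * (π / 2 * x)) ^ (2 * a + 2) * (cos (π / 2 * x) / sin (π / 2 * x)) *
      (π - 2 * (π / 2 * x)) ^ (2 * b + 1) =
      π ^ (2 * a + 2 * b + 3) * (x ^ (2 * a + 2) * (1 - x) ^ (2 * b + 1) *
        (cos (π * x / 2) / sin (π * x / 2))) := by
    intro x
    rw [show π / 2 * x = π * x / 2 by ring, show 2 * (π * x / 2) = π * x by ring,
      show π - π * x = π * (1 - x) by ring, mul_pow, mul_pow]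
    ring
  simp_rw [e] at h
  rw [intervalIntegral.integral_const_mul] at h
  rw [h, smul_eq_mul]
  field_simp

/-! ### Theorem 3.3: the cotangent moments of `x^{2a+2}(1-x)^{2b+1}` -/

section Polynomials

open Polynomial

/-- The polynomial `P_{a,b} = X^{2a+2} (1 - X)^{2b+1}`. [folklore] -/
def hoffPoly (a b : ℕ) : ℝ[X] := X ^ (2 * a + 2) * (1 - X) ^ (2 * b + 1)

/-- `P_{a,b}(x) = x^{2a+2}(1-x)^{2b+1}`. [folklore] -/
theorem hoffPoly_eval (a b : ℕ) (x : ℝ) :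
    (hoffPoly a b).eval x = x ^ (2 * a + 2) * (1 - x) ^ (2 * b + 1) := by
  simp [hoffPoly]

/-- `P_{a,b}(0) = 0`. [folklore] -/
theorem hoffPoly_eval_zero (a b : ℕ) : (hoffPoly a b).eval 0 = 0 := by
  simp [hoffPoly_eval]

/-- `P_{a,b}(1) = 0`. [folklore] -/
theorem hoffPoly_eval_one (a b : ℕ) : (hoffPoly a b).eval 1 = 0 := by
  simp [hoffPoly_eval]

/-- `deg P_{a,b} ≤ 2a+2b+3 < 2(a+b+2)`. [folklore] -/
theorem natDegree_hoffPoly_lt (a b : ℕ) : (hoffPoly a b).natDegree < 2 * (a + b + 2) := by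
  unfold hoffPoly
  have h1 : (X ^ (2 * a + 2) : ℝ[X]).natDegree ≤ 2 * a + 2 := natDegree_X_pow_le _
  have h2 : ((1 - X : ℝ[X]) ^ (2 * b + 1)).natDegree ≤ 2 * b + 1 := by
    refine (natDegree_pow_le).trans ?_
    have : (1 - X : ℝ[X]).natDegree ≤ 1 := by
      refine (natDegree_sub_le _ _).trans ?_
      simp
    calc (2 * b + 1) * (1 - X : ℝ[X]).natDegree ≤ (2 * b + 1) * 1 := Nat.mul_le_mul_left _ this
      _ = 2 * b + 1 := mul_one _
  calc (X ^ (2 * a + 2) * (1 - X) ^ (2 * b + 1) : ℝ[X]).natDegree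
      ≤ (X ^ (2 * a + 2) : ℝ[X]).natDegree + ((1 - X : ℝ[X]) ^ (2 * b + 1)).natDegree :=
        natDegree_mul_le
    _ ≤ (2 * a + 2) + (2 * b + 1) := add_le_add h1 h2
    _ < 2 * (a + b + 2) := by omega

/-- The coefficients of `(1 - X)^m`. [folklore] -/
theorem coeff_one_sub_X_pow (m k : ℕ) :
    ((1 - X : ℝ[X]) ^ m).coeff k = (-1) ^ k * (m.choose k : ℝ) := by
  have e : (1 - X : ℝ[X]) = C (-1) * (X + C (-1)) := by
    simp only [map_neg, C_1, neg_mul, one_mul, neg_add_rev, neg_neg]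
    ring
  rw [e, mul_pow, ← C_pow, coeff_C_mul, coeff_X_add_C_pow]
  rcases le_or_gt k m with hk | hk
  · obtain ⟨d, rfl⟩ := Nat.exists_eq_add_of_le hk
    rw [Nat.add_sub_cancel_left]
    have h1 : (-1 : ℝ) ^ (k + d) * (-1) ^ d = (-1) ^ k := by
      rw [pow_add, mul_assoc, ← pow_add, ← two_mul, pow_mul, neg_one_sq, one_pow, mul_one]
    rw [← mul_assoc, h1]
  · rw [Nat.choose_eq_zero_of_lt hk]
    simp

/-- `P⁽ᵏ⁾(0) = k! · [Xᵏ] P`. [folklore] -/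
theorem iterate_derivative_eval_zero (p : ℝ[X]) (k : ℕ) :
    (derivative^[k] p).eval 0 = k ! * p.coeff k := by
  rw [← coeff_zero_eq_eval_zero, coeff_iterate_derivative, zero_add, Nat.descFactorial_self,
    nsmul_eq_mul]

/-- The coefficients of `P_{a,b}`. [folklore] -/
theorem coeff_hoffPoly (a b k : ℕ) :
    (hoffPoly a b).coeff k =
      if 2 * a + 2 ≤ k then (-1) ^ (k - (2 * a + 2)) * ((2 * b + 1).choose (k - (2 * a + 2)) : ℝ)
      else 0 := by
  rw [hoffPoly, coeff_X_pow_mul']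
  split_ifs with h
  · rw [coeff_one_sub_X_pow]
  · rfl

/-- `P_{a,b}⁽²ʲ⁾(0) = (2j)! C(2b+1, 2j-2a-2)` for `a + 1 ≤ j`, and `0` otherwise.
[cite: LaiLupuOrr2026, proof of Theorem 3.3] -/
theorem iterate_derivative_hoffPoly_eval_zero (a b j : ℕ) :
    (derivative^[2 * j] (hoffPoly a b)).eval 0 =
      if a + 1 ≤ j then ((2 * j)! : ℝ) * ((2 * b + 1).choose (2 * j - (2 * a + 2)) : ℝ) else 0 := by
  rw [iterate_derivative_eval_zero, coeff_hoffPoly]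
  by_cases h : a + 1 ≤ j
  · rw [if_pos (by omega), if_pos h]
    have he : 2 * j - (2 * a + 2) = 2 * (j - (a + 1)) := by omega
    rw [he, pow_mul, neg_one_sq, one_pow, one_mul]
  · rw [if_neg (by omega), if_neg h, mul_zero]

/-- The mirror polynomial `Q_{a,b} = X^{2b+1} (1 - X)^{2a+2}` with `P_{a,b} = Q_{a,b}(1 - X)`. [folklore] -/
def hoffPoly' (a b : ℕ) : ℝ[X] := X ^ (2 * b + 1) * (1 - X) ^ (2 * a + 2)

/-- `Q_{a,b}(1 - X) = P_{a,b}`. [folklore] -/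
theorem hoffPoly'_comp (a b : ℕ) : (hoffPoly' a b).comp (1 - X) = hoffPoly a b := by
  rw [hoffPoly', hoffPoly, mul_comp, pow_comp, pow_comp, X_comp, sub_comp, one_comp, X_comp,
    sub_sub_cancel, mul_comm]

/-- The coefficients of `Q_{a,b}`. [folklore] -/
theorem coeff_hoffPoly' (a b k : ℕ) :
    (hoffPoly' a b).coeff k =
      if 2 * b + 1 ≤ k then (-1) ^ (k - (2 * b + 1)) * ((2 * a + 2).choose (k - (2 * b + 1)) : ℝ)
      else 0 := by
  rw [hoffPoly', coeff_X_pow_mul']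
  split_ifs with h
  · rw [coeff_one_sub_X_pow]
  · rfl

/-- Derivatives of `p(1 - X)`: `(p ∘ (1-X))⁽ᵏ⁾ = (-1)ᵏ p⁽ᵏ⁾ ∘ (1-X)`. [folklore] -/
theorem iterate_derivative_comp_one_sub_X (p : ℝ[X]) : ∀ k : ℕ,
    derivative^[k] (p.comp (1 - X)) = C ((-1 : ℝ) ^ k) * (derivative^[k] p).comp (1 - X)
  | 0 => by simp
  | k + 1 => by
      rw [Function.iterate_succ_apply', iterate_derivative_comp_one_sub_X p k, derivative_C_mul,
        derivative_comp, derivative_sub, derivative_one, derivative_X, zero_sub,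
        Function.iterate_succ_apply', pow_succ, C_mul, C_neg, C_1]
      ring

/-- `P_{a,b}⁽²ʲ⁾(1) = -(2j)! C(2a+2, 2j-2b-1)` for `b + 1 ≤ j`, and `0` otherwise.
[cite: LaiLupuOrr2026, proof of Theorem 3.3] -/
theorem iterate_derivative_hoffPoly_eval_one (a b j : ℕ) :
    (derivative^[2 * j] (hoffPoly a b)).eval 1 =
      if b + 1 ≤ j then -(((2 * j)! : ℝ) * ((2 * a + 2).choose (2 * j - (2 * b + 1)) : ℝ)) else 0 := by
  rw [← hoffPoly'_comp, iterate_derivative_comp_one_sub_X, pow_mul, neg_one_sq, one_pow, C_1, one_mul,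
    eval_comp, eval_sub, eval_one, eval_X, sub_self, iterate_derivative_eval_zero, coeff_hoffPoly']
  by_cases h : b + 1 ≤ j
  · rw [if_pos (by omega), if_pos h]
    have he : 2 * j - (2 * b + 1) = 2 * (j - (b + 1)) + 1 := by omega
    rw [he, pow_succ, pow_mul, neg_one_sq, one_pow, one_mul]
    ring
  · rw [if_neg (by omega), if_neg h, mul_zero]

end Polynomials

/-! ### The two binomial bookkeeping identities of the proof of Theorem 3.3 -/

/-- `(2j)! C(2b+1, 2j-2a-2) (2n+1-2j)! = (2a+2)! (2b+1)! C(2j, 2a+2)` (`n = a+b+1`, `a+1 ≤ j ≤ n`),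
in the solved form used below. [cite: LaiLupuOrr2026, proof of Theorem 3.3] -/
theorem choose_identity_zero {a b j : ℕ} (h1 : a + 1 ≤ j) (h2 : j ≤ a + b + 1) :
    ((2 * j)! : ℝ) * ((2 * b + 1).choose (2 * j - (2 * a + 2)) : ℝ) =
      (2 * a + 2)! * (2 * b + 1)! * ((2 * j).choose (2 * a + 2) : ℝ) /
        (2 * (a + b + 1) + 1 - 2 * j)! := by
  set k := 2 * j - (2 * a + 2) with hk
  have hk1 : k ≤ 2 * b + 1 := by omega
  have hk2 : 2 * a + 2 ≤ 2 * j := by omega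
  have e1 := Nat.choose_mul_factorial_mul_factorial hk1
  have e2 := Nat.choose_mul_factorial_mul_factorial hk2
  have hm : 2 * b + 1 - k = 2 * (a + b + 1) + 1 - 2 * j := by omega
  rw [hm] at e1
  rw [← hk] at e2
  have e1' : (((2 * b + 1).choose k : ℕ) : ℝ) * (k ! : ℝ) * ((2 * (a + b + 1) + 1 - 2 * j)! : ℝ) =
      ((2 * b + 1)! : ℝ) := by exact_mod_cast e1
  have e2' : (((2 * j).choose (2 * a + 2) : ℕ) : ℝ) * ((2 * a + 2)! : ℝ) * (k ! : ℝ) = ((2 * j)! : ℝ) := by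
    exact_mod_cast e2
  have hkf : (k ! : ℝ) ≠ 0 := by positivity
  have hmf : ((2 * (a + b + 1) + 1 - 2 * j)! : ℝ) ≠ 0 := by positivity
  rw [eq_div_iff hmf]
  apply mul_left_cancel₀ hkf
  linear_combination ((2 * j)! : ℝ) * e1' - ((2 * b + 1)! : ℝ) * e2'

/-- `(2j)! C(2a+2, 2j-2b-1) (2n+1-2j)! = (2a+2)! (2b+1)! C(2j, 2b+1)` (`n = a+b+1`, `b+1 ≤ j ≤ n`),
in the solved form used below. [cite: LaiLupuOrr2026, proof of Theorem 3.3] -/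
theorem choose_identity_one {a b j : ℕ} (h1 : b + 1 ≤ j) (h2 : j ≤ a + b + 1) :
    ((2 * j)! : ℝ) * ((2 * a + 2).choose (2 * j - (2 * b + 1)) : ℝ) =
      (2 * a + 2)! * (2 * b + 1)! * ((2 * j).choose (2 * b + 1) : ℝ) /
        (2 * (a + b + 1) + 1 - 2 * j)! := by
  set k := 2 * j - (2 * b + 1) with hk
  have hk1 : k ≤ 2 * a + 2 := by omega
  have hk2 : 2 * b + 1 ≤ 2 * j := by omega
  have e1 := Nat.choose_mul_factorial_mul_factorial hk1
  have e2 := Nat.choose_mul_factorial_mul_factorial hk2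
  have hm : 2 * a + 2 - k = 2 * (a + b + 1) + 1 - 2 * j := by omega
  rw [hm] at e1
  rw [← hk] at e2
  have e1' : (((2 * a + 2).choose k : ℕ) : ℝ) * (k ! : ℝ) * ((2 * (a + b + 1) + 1 - 2 * j)! : ℝ) =
      ((2 * a + 2)! : ℝ) := by exact_mod_cast e1
  have e2' : (((2 * j).choose (2 * b + 1) : ℕ) : ℝ) * ((2 * b + 1)! : ℝ) * (k ! : ℝ) = ((2 * j)! : ℝ) := by
    exact_mod_cast e2
  have hkf : (k ! : ℝ) ≠ 0 := by positivity
  have hmf : ((2 * (a + b + 1) + 1 - 2 * j)! : ℝ) ≠ 0 := by positivity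
  rw [eq_div_iff hmf]
  apply mul_left_cancel₀ hkf
  linear_combination ((2 * j)! : ℝ) * e1' - ((2 * a + 2)! : ℝ) * e2'

/-- **Theorem 3.3 of Lai–Lupu–Orr**:
`∫₀¹ x^{2a+2}(1-x)^{2b+1} cot(πx/2) dx
  = 2 (2a+2)! (2b+1)! ∑_{r<n} (-1)^{r+1} [C(2r+2,2a+2) - (1 - 4^{-(r+1)}) C(2r+2,2b+1)]
      ζ(2r+3) / ((2n-1-2r)! π^{2r+3})`, `n = a + b + 1`.
[cite: LaiLupuOrr2026, Theorem 3.3] -/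
theorem integral_hoffPoly_mul_cot (a b : ℕ) :
    ∫ x in (0 : ℝ)..1, x ^ (2 * a + 2) * (1 - x) ^ (2 * b + 1) * (cos (π * x / 2) / sin (π * x / 2)) =
      2 * ((2 * a + 2)! * (2 * b + 1)!) * ∑ r ∈ Finset.range (a + b + 1), (-1 : ℝ) ^ (r + 1) *
        ((((2 * r + 2).choose (2 * a + 2) : ℕ) : ℝ) -
          (1 - 1 / 4 ^ (r + 1)) * (((2 * r + 2).choose (2 * b + 1) : ℕ) : ℝ)) *
        (∑' m : ℕ, 1 / ((m : ℝ) + 1) ^ (2 * r + 3)) /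
          (((2 * (a + b + 1) + 1 - (2 * r + 2))! : ℝ) * π ^ (2 * r + 3)) := by
  have h := Literature.Analysis.SpecialFunctions.integral_polynomial_mul_cot (hoffPoly a b)
    (hoffPoly_eval_zero a b) (hoffPoly_eval_one a b) (natDegree_hoffPoly_lt a b)
  simp_rw [hoffPoly_eval] at h
  rw [h, show a + b + 2 = (a + b + 1) + 1 by ring, Finset.sum_Ico_eq_sum_range,
    show a + b + 1 + 1 - 1 = a + b + 1 by omega, Finset.mul_sum, Finset.mul_sum]
  refine Finset.sum_congr rfl fun r hr => ?_
  rw [Finset.mem_range] at hr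
  rw [show 2 * (1 + r) = 2 * (r + 1) by ring, iterate_derivative_hoffPoly_eval_zero,
    iterate_derivative_hoffPoly_eval_one]
  -- the two coefficient values, including the vanishing cases
  have c0 : (if a + 1 ≤ r + 1 then ((2 * (r + 1))! : ℝ) * ((2 * b + 1).choose (2 * (r + 1) - (2 * a + 2)) : ℝ)
      else 0) = (2 * a + 2)! * (2 * b + 1)! * ((2 * r + 2).choose (2 * a + 2) : ℝ) /
        (2 * (a + b + 1) + 1 - (2 * r + 2))! := by
    split_ifs with hc
    · rw [choose_identity_zero hc (by omega), show 2 * (r + 1) = 2 * r + 2 by ring]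
    · rw [Nat.choose_eq_zero_of_lt (by omega)]
      simp
  have c1 : (if b + 1 ≤ r + 1 then -(((2 * (r + 1))! : ℝ) * ((2 * a + 2).choose (2 * (r + 1) - (2 * b + 1)) : ℝ))
      else 0) = -((2 * a + 2)! * (2 * b + 1)! * ((2 * r + 2).choose (2 * b + 1) : ℝ) /
        (2 * (a + b + 1) + 1 - (2 * r + 2))!) := by
    split_ifs with hc
    · rw [choose_identity_one hc (by omega), show 2 * (r + 1) = 2 * r + 2 by ring]
    · rw [Nat.choose_eq_zero_of_lt (by omega)]
      simp
  rw [c0, c1, show 2 * (r + 1) + 1 = 2 * r + 3 by ring, show 1 + r = r + 1 by ring]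
  have hf : (((2 * (a + b + 1) + 1 - (2 * r + 2))! : ℕ) : ℝ) ≠ 0 := by positivity
  have hπ : π ^ (2 * r + 3) ≠ 0 := by positivity
  have h4 : (4 : ℝ) ^ (r + 1) ≠ 0 := by positivity
  field_simp
  ring

/-! ### Zagier's theorem for all `a, b` and the Hoffman reduction without `hZ` -/

open Brown2012 (zagierA zagierB zagierA_def zagierB_def)

/-- The coefficient of Zagier's formula: `A^{r+1}_{a} - B^{r+1}_{b}` in real terms.
[cite: Brown2012, §4 (before Theorem 4.1)] -/
theorem cast_zagierA_sub_zagierB (r a b : ℕ) :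
    ((zagierA (r + 1) a - zagierB (r + 1) b : ℚ) : ℝ) =
      (((2 * r + 2).choose (2 * a + 2) : ℕ) : ℝ) -
        (1 - 1 / 4 ^ (r + 1)) * (((2 * r + 2).choose (2 * b + 1) : ℕ) : ℝ) := by
  rw [zagierA_def, zagierB_def]
  have e : ((2 : ℚ) ^ (2 * (r + 1)))⁻¹ = 1 / 4 ^ (r + 1) := by rw [pow_mul]; norm_num
  rw [e, show 2 * (r + 1) = 2 * r + 2 by ring]
  push_cast
  ring

/-- **Zagier's theorem** (Zagier 2012, Theorem 1 = Brown 2012, Theorem 4.1 = Lai–Lupu–Orr 2026,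
Theorem 1.1), for ALL `a, b ≥ 0`, in the tree's conventions:
`ζ(2ᵃ 3 2ᵇ) = 2 ∑_{r=0}^{a+b} (-1)^{r+1} (A^{r+1}_a - B^{r+1}_b) ζ(2r+3) ζ({2}^{a+b-r})`.
[cite: Zagier2012, Theorem 1] [cite: Brown2012, Theorem 4.1] [cite: LaiLupuOrr2026, Theorem 1.1] -/
theorem zagier_theorem (a b : ℕ) :
    multipleZeta (List.replicate b 2 ++ 3 :: List.replicate a 2) =
      2 * ∑ r ∈ Finset.range (a + b + 1), (-1 : ℝ) ^ (r + 1) *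
        ((zagierA (r + 1) a - zagierB (r + 1) b : ℚ) : ℝ) *
          (multipleZeta [2 * r + 3] * multipleZeta (List.replicate (a + b - r) 2)) := by
  have h1 := integral_cot_hoffman_unit a b
  rw [integral_hoffPoly_mul_cot] at h1
  have hF : ((2 * a + 2)! : ℝ) * (2 * b + 1)! ≠ 0 := by positivity
  -- compare termwise
  have key : ∀ r ∈ Finset.range (a + b + 1),
      π ^ (2 * a + 2 * b + 3) * (2 * (((2 * a + 2)! : ℝ) * (2 * b + 1)!) * ((-1 : ℝ) ^ (r + 1) *
        ((((2 * r + 2).choose (2 * a + 2) : ℕ) : ℝ) -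
          (1 - 1 / 4 ^ (r + 1)) * (((2 * r + 2).choose (2 * b + 1) : ℕ) : ℝ)) *
        (∑' m : ℕ, 1 / ((m : ℝ) + 1) ^ (2 * r + 3)) /
          (((2 * (a + b + 1) + 1 - (2 * r + 2))! : ℝ) * π ^ (2 * r + 3)))) =
      ((2 * a + 2)! : ℝ) * (2 * b + 1)! * (2 * ((-1 : ℝ) ^ (r + 1) *
        ((zagierA (r + 1) a - zagierB (r + 1) b : ℚ) : ℝ) *
          (multipleZeta [2 * r + 3] * multipleZeta (List.replicate (a + b - r) 2)))) := by
    intro r hr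
    rw [Finset.mem_range] at hr
    rw [cast_zagierA_sub_zagierB, multipleZeta_singleton_holds (by omega : 2 ≤ 2 * r + 3),
      multipleZeta_replicate_two, show 2 * (a + b + 1) + 1 - (2 * r + 2) = 2 * (a + b - r) + 1 by omega,
      show 2 * a + 2 * b + 3 = 2 * (a + b - r) + (2 * r + 3) by omega, pow_add]
    have hf : (((2 * (a + b - r) + 1)! : ℕ) : ℝ) ≠ 0 := by positivity
    have hπ : π ^ (2 * r + 3) ≠ 0 := by positivity
    field_simp
  have hsum : π ^ (2 * a + 2 * b + 3) * (2 * (((2 * a + 2)! : ℝ) * (2 * b + 1)!) *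
      ∑ r ∈ Finset.range (a + b + 1), ((-1 : ℝ) ^ (r + 1) *
        ((((2 * r + 2).choose (2 * a + 2) : ℕ) : ℝ) -
          (1 - 1 / 4 ^ (r + 1)) * (((2 * r + 2).choose (2 * b + 1) : ℕ) : ℝ)) *
        (∑' m : ℕ, 1 / ((m : ℝ) + 1) ^ (2 * r + 3)) /
          (((2 * (a + b + 1) + 1 - (2 * r + 2))! : ℝ) * π ^ (2 * r + 3)))) =
      ((2 * a + 2)! : ℝ) * (2 * b + 1)! * (2 * ∑ r ∈ Finset.range (a + b + 1), ((-1 : ℝ) ^ (r + 1) *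
        ((zagierA (r + 1) a - zagierB (r + 1) b : ℚ) : ℝ) *
          (multipleZeta [2 * r + 3] * multipleZeta (List.replicate (a + b - r) 2)))) := by
    rw [Finset.mul_sum, Finset.mul_sum, Finset.mul_sum, Finset.mul_sum]
    exact Finset.sum_congr rfl key
  rw [hsum] at h1
  exact (mul_left_cancel₀ hF h1).symm

/-- **Zagier's theorem, as printed** (Zagier 2012, Theorem 1; Lai–Lupu–Orr 2026, Theorem 1.1):
`H(a,b) = 2 ∑_{k=1}^{a+b+1} (-1)ᵏ [C(2k,2a+2) - (1 - 2^{-2k}) C(2k,2b+1)] ζ(2k+1) H(a+b+1-k)`,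
`H(a,b) = ζ(2ᵃ 3 2ᵇ) = multipleZeta (replicate b 2 ++ 3 :: replicate a 2)`, `H(m) = ζ({2}ᵐ)`.
[cite: Zagier2012, Theorem 1] [cite: LaiLupuOrr2026, Theorem 1.1] -/
theorem zagier_theorem_printed (a b : ℕ) :
    multipleZeta (List.replicate b 2 ++ 3 :: List.replicate a 2) =
      2 * ∑ k ∈ Finset.Ico 1 (a + b + 2), (-1 : ℝ) ^ k *
        ((((2 * k).choose (2 * a + 2) : ℕ) : ℝ) -
          (1 - 1 / 2 ^ (2 * k)) * (((2 * k).choose (2 * b + 1) : ℕ) : ℝ)) *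
        multipleZeta [2 * k + 1] * multipleZeta (List.replicate (a + b + 1 - k) 2) := by
  rw [zagier_theorem, show a + b + 2 = (a + b + 1) + 1 by ring, Finset.sum_Ico_eq_sum_range,
    show a + b + 1 + 1 - 1 = a + b + 1 by omega]
  congr 1
  refine Finset.sum_congr rfl fun r hr => ?_
  rw [Finset.mem_range] at hr
  rw [cast_zagierA_sub_zagierB, show 1 + r = r + 1 by ring,
    show (2 : ℝ) ^ (2 * (r + 1)) = 4 ^ (r + 1) by rw [pow_mul]; norm_num,
    show 2 * (r + 1) = 2 * r + 2 by ring, show 2 * r + 2 + 1 = 2 * r + 3 by ring,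
    show a + b + 1 - (r + 1) = a + b - r by omega]
  ring

/-- **Zagier's theorem in the shape `hZ`** of `BrownLevelOneProofs` / `BrownDepthOneLift`:
for every `n` and `b < n`, the word `2ᵇ 3 2^{n-1-b}` of weight `2n+1`.
[cite: Zagier2012, Theorem 1] [cite: Brown2012, Theorem 4.1] -/
theorem zagier_theorem_hZ (n b : ℕ) (hb : b < n) :
    multipleZeta (List.replicate b 2 ++ 3 :: List.replicate (n - 1 - b) 2) =
      2 * ∑ r ∈ Finset.range n, (-1 : ℝ) ^ (r + 1) *
        ((zagierA (r + 1) (n - 1 - b) - zagierB (r + 1) b : ℚ) : ℝ) *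
          (multipleZeta [2 * r + 3] * multipleZeta (List.replicate (n - 1 - r) 2)) := by
  have h := zagier_theorem (n - 1 - b) b
  rw [show n - 1 - b + b + 1 = n by omega] at h
  rw [h]
  congr 1
  refine Finset.sum_congr rfl fun r hr => ?_
  rw [Finset.mem_range] at hr
  rw [show n - 1 - b + b - r = n - 1 - r by omega]

end LaiLupuOrr

/-! ### Consequences: Brown's theorem at level one unconditionally, and the Hoffman reduction
without the hypothesis `hZ` -/

/-- **`ζ(2j+3) ζ({2}^{n-1-j}) ∈ hoffmanSpan (2n+1)`** for all `j < n` — Brown's Theorem 1.1 for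
these products, now UNCONDITIONAL (Zagier's theorem proved above + Brown's `2`-adic level-one
argument `Brown2012.multipleZeta_odd_mul_twos_mem_hoffmanSpan_of_zagier`).
[cite: Brown2012, Theorems 1.1, 7.3 and 7.4] -/
theorem multipleZeta_odd_mul_twos_mem_hoffmanSpan (n j : ℕ) (hj : j < n) :
    multipleZeta [2 * j + 3] * multipleZeta (List.replicate (n - 1 - j) 2) ∈ hoffmanSpan (2 * n + 1) :=
  multipleZeta_odd_mul_twos_mem_hoffmanSpan_of_zagier n
    (fun b hb => LaiLupuOrr.zagier_theorem_hZ n b hb) j hj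

/-- **Every odd zeta value is a rational combination of Hoffman elements**:
`ζ(2n+1) ∈ hoffmanSpan (2n+1)` for all `n ≥ 1` (Brown 2012, Theorem 1.1 in depth one; here with
an unconditional, motivic-free proof: Zagier's theorem + the `2`-adic Lemma 7.1).
[cite: Brown2012, Theorems 1.1, 7.3 and 7.4] -/
theorem multipleZeta_odd_mem_hoffmanSpan (n : ℕ) (hn : 1 ≤ n) :
    multipleZeta [2 * n + 1] ∈ hoffmanSpan (2 * n + 1) :=
  multipleZeta_odd_mem_hoffmanSpan_of_zagier n hn
    (fun b hb => LaiLupuOrr.zagier_theorem_hZ n b hb)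

/-- `π^{2(n-1-j)} ζ(2j+3) ∈ hoffmanSpan (2n+1)` for all `j < n`, unconditionally.
[cite: Brown2012, Theorems 1.1, 7.3 and 7.4] -/
theorem pi_pow_mul_multipleZeta_odd_mem_hoffmanSpan (n j : ℕ) (hj : j < n) :
    π ^ (2 * (n - 1 - j)) * multipleZeta [2 * j + 3] ∈ hoffmanSpan (2 * n + 1) :=
  pi_pow_mul_multipleZeta_odd_mem_hoffmanSpan_of_zagier n
    (fun b hb => LaiLupuOrr.zagier_theorem_hZ n b hb) j hj

/-- **Brown's Hoffman theorem from the motivic coaction structure alone.** The reduction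
`hoffmanSpan_eq_mzvSpace_of_fullCoactionData` of `BrownDepthOneLift` with its hypothesis `hZ`
(Zagier's real theorem) now DISCHARGED: the named fact `hoffmanSpan_eq_mzvSpace` follows from an
inhabitant of `Brown2012.FullCoactionData` (motivic MZVs with the Goncharov–Brown coaction, Brown's
Theorem 3.3 and the period map). [cite: Brown2012, Theorem 1.1, §7.2 and Theorem 4.1] -/
theorem hoffmanSpan_eq_mzvSpace_of_fullCoactionData' (F : Brown2012.FullCoactionData) :
    hoffmanSpan_eq_mzvSpace :=
  hoffmanSpan_eq_mzvSpace_of_fullCoactionData F (fun n b hb => LaiLupuOrr.zagier_theorem_hZ n b hb)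

/-- **Brown's Hoffman theorem from `UCoactionData` alone** (motivic MZVs with coaction and an
injective, derivation-compatible `φ : H ↪ 𝒰`, Brown 2012 §§2–3): the hypothesis `hZ` of
`hoffmanSpan_eq_mzvSpace_of_uCoactionData` is discharged by Zagier's theorem proved above.
[cite: Brown2012, Theorem 1.1, §7.2 and Theorem 4.1] -/
theorem hoffmanSpan_eq_mzvSpace_of_uCoactionData' (G : Brown2012.UCoactionData) :
    hoffmanSpan_eq_mzvSpace :=
  hoffmanSpan_eq_mzvSpace_of_uCoactionData G (fun n b hb => LaiLupuOrr.zagier_theorem_hZ n b hb)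
end Literature.NumberTheory.Transcendental
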